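import Summits.ResolutionOfSingularities.KangarooAtlas.MizutaniExtremal
import HarnessLib

/-!
# Example: purely inseparable points with FEW coordinates have `B_{P,𝔭} = 𝔸^{n+1}` — e.g. the point `X_1^p = a X_0^p` of `ℙ¹`

Cell `pub-rosobs`, Mizutani enclosure (seat mizutani-encloser-2, gen 6). AI-written; AI review is weaker than expert
review; NOT a resolution-of-singularities theorem (summit relevance C).

A reviewer-facing sanity check complementing `MizutaniExamples.lean` (generic point, rational point) and the extremal schemes
(`MizutaniExtremal*.lean`): the `k^{1/p}`-rational point `[c_0^{1/p} : ⋯ : c_n^{1/p}]` of a vector `c` with `k^p`-linearly independent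
coordinates has NO linear form through it, and as long as `n + 1 < 2p` it carries NO invariant additive form at all — its Hironaka scheme is
the whole vector group: `U(𝔭) = k`, `U_+(𝔭)S = 0`, `B_{P,𝔭} = 𝔸^{n+1}`, exponent `0` (a non-generic point with `B = 𝔸^{n+1}`; the level-one bound
`2p + dim (L_B)_1 ≤ n + 2` of `MizutaniExtremal.lean` forbids invariant forms of level one, hence of any level).  In particular:

* **`bIdeal_ratPoint_eq_bot_of_lt`** / `exponent_ratPoint_eq_zero_of_lt` / `ringKrullDim_quotient_bIdeal_ratPoint_of_lt` — for `n + 1 < 2p`;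
* **`bIdeal_inseparablePoint_eq_bot`** — the point `(X_1^p − a X_0^p)` of `ℙ¹_k`, `a ∉ k^p` (every `p`): `B = 𝔸²`.

## References

* H. Mizutani, *Hironaka's additive group schemes*, Nagoya Math. J. 52 (1973) 85–95, Def. 1.1, Rem. 1.2, Thm. 2.8 (first part).
  [Mizutani1973HironakaGroupSchemes]
-/

noncomputable section

open MvPolynomial TensorProduct Literature.AlgebraicGeometry.Resolution
  Literature.AlgebraicGeometry.Resolution.HironakaScheme

namespace Summit.ResolutionOfSingularities.KangarooAtlas.Mizutani

universe u

section Inseparable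

variable (k : Type u) [Field k] (p : ℕ) [hp : Fact p.Prime] [CharP k p] {n : ℕ}

/-- **No invariant additive form at a `k^{1/p}`-rational point with `< 2p` independent coordinates**: for `c` with `k^p`-linearly independent
coordinates and `n + 1 < 2p`, `(L_B)_e([c^{1/p}]) = 0` for every `e` (the exponent is `0`: a new form at the exact exponent `E ≥ 1` would need
`2p^E ≤ dim + 1 ≤ n + 1`). [cite: Mizutani1973HironakaGroupSchemes, Thm. 2.8 (first part: a non-vector-group has dim ≥ 2p − 1)] -/
theorem invForms_ratPoint_eq_bot_of_lt {c : Fin (n + 1) → k} (hc : LinearIndependent (frobPow k p 1) c) (hN : n + 1 < 2 * p)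
    (e : ℕ) : invForms k p (ratPoint k p 1 c) e = ⊥ := by
  set 𝔭 := ratPoint k p 1 c with h𝔭
  have hc0 : c ≠ 0 := fun h => hc.ne_zero 0 (congrFun h 0)
  have hP : IsPoint k 𝔭 := isPoint_ratPoint hc0
  have h0 : invForms k p 𝔭 0 = ⊥ := invForms_ratPoint_zero_eq_bot hc
  -- the exponent is `0`
  have hE0 : ExponentLE k p 𝔭 0 := by
    obtain ⟨E, hE, hmin, -⟩ := exists_exact_exponent k p 𝔭 (exponentLE_exponent k p 𝔭)
    rcases Nat.eq_zero_or_pos E with rfl | hpos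
    · exact hE
    · exfalso
      obtain ⟨E', rfl⟩ : ∃ E', E = E' + 1 := ⟨E - 1, by omega⟩
      have hbound := two_mul_pow_le_hsDimAt_succ k p 𝔭 hP E' hE (hmin E' (Nat.lt_succ_self E'))
      obtain ⟨a, ha, hnot⟩ := exists_mem_invForms_not_mem_span k p 𝔭 ratPoint_ne_top hE (hmin E' (Nat.lt_succ_self E'))
      have ha0 : a ≠ 0 := fun h => hnot (h ▸ Submodule.zero_mem _)
      haveI : FiniteDimensional k (invForms k p 𝔭 (E' + 1)) := FiniteDimensional.finiteDimensional_submodule _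
      have h1 : 1 ≤ Module.finrank k (invForms k p 𝔭 (E' + 1)) := by
        have := Submodule.finrank_mono (Submodule.span_le.mpr (Set.singleton_subset_iff.mpr ha) :
          Submodule.span k {a} ≤ invForms k p 𝔭 (E' + 1))
        rwa [finrank_span_singleton ha0] at this
      have hpow : 2 * p ≤ 2 * p ^ (E' + 1) :=
        Nat.mul_le_mul_left 2 (le_self_pow (n := E' + 1) hp.out.one_lt.le (Nat.succ_ne_zero E') |>.trans' (le_refl p) |> fun h =>
          by simpa using (Nat.pow_le_pow_right hp.out.pos (Nat.succ_le_succ (Nat.zero_le E')) : p ^ 1 ≤ p ^ (E' + 1)))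
      unfold hsDimAt at hbound
      omega
  rw [hE0 e (Nat.zero_le e), h0, Nat.sub_zero, Submodule.bot_coe, Set.image_singleton]
  have : frobVec k p e (0 : Fin (n + 1) → k) = 0 := by
    funext j
    rw [frobVec, Pi.zero_apply, zero_pow (pow_ne_zero _ hp.out.ne_zero)]
  rw [this, Submodule.span_zero_singleton]

/-- **`B_{P,[c^{1/p}]} = 𝔸^{n+1}` when `n + 1 < 2p`**: the ideal `U_+(𝔭)S` of the Hironaka scheme of a `k^{1/p}`-rational point with `k^p`-independent
coordinates in `ℙ^n`, `n + 1 < 2p`, is zero. [cite: Mizutani1973HironakaGroupSchemes, Def. 1.1 and Thm. 2.8 (first part)] -/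
theorem bIdeal_ratPoint_eq_bot_of_lt {c : Fin (n + 1) → k} (hc : LinearIndependent (frobPow k p 1) c) (hN : n + 1 < 2 * p) :
    bIdeal k (ratPoint k p 1 c) = ⊥ := by
  have hc0 : c ≠ 0 := fun h => hc.ne_zero 0 (congrFun h 0)
  have hP : IsPoint k (ratPoint k p 1 c) := isPoint_ratPoint hc0
  haveI := hP.1
  rw [bIdeal_eq_famIdeal_hirForms_holds k p _ hP]
  unfold famIdeal
  rw [Ideal.span_eq_bot]
  intro f hf
  obtain ⟨e, hfe⟩ := Set.mem_iUnion.mp hf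
  obtain ⟨a, ha, rfl⟩ := hfe
  rw [SetLike.mem_coe, hirForms_eq_invForms _ e, invForms_ratPoint_eq_bot_of_lt k p hc hN e, Submodule.mem_bot] at ha
  rw [ha]
  unfold addForm
  exact Finset.sum_eq_zero fun j _ => by rw [Pi.zero_apply, C_0, zero_mul]

/-- … so `dim B_{P,[c^{1/p}]} = n + 1`. [cite: Mizutani1973HironakaGroupSchemes, Def. 1.1] -/
theorem ringKrullDim_quotient_bIdeal_ratPoint_of_lt {c : Fin (n + 1) → k} (hc : LinearIndependent (frobPow k p 1) c)
    (hN : n + 1 < 2 * p) :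
    ringKrullDim (MvPolynomial (Fin (n + 1)) k ⧸ bIdeal k (ratPoint k p 1 c)) = ((n + 1 : ℕ) : WithBot ℕ∞) := by
  rw [bIdeal_ratPoint_eq_bot_of_lt k p hc hN]
  exact (RingEquiv.ringKrullDim (RingEquiv.quotientBot _)).trans (by
    rw [MvPolynomial.ringKrullDim_of_isNoetherianRing, ringKrullDim_eq_zero_of_field, Nat.card_eq_fintype_card,
      Fintype.card_fin, zero_add])

/-- … and the exponent is `0` (a vector group). [cite: Mizutani1973HironakaGroupSchemes, Rem. 1.2] -/
theorem exponent_ratPoint_eq_zero_of_lt {c : Fin (n + 1) → k} (hc : LinearIndependent (frobPow k p 1) c) (hN : n + 1 < 2 * p) :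
    exponent k p (ratPoint k p 1 c) = 0 := by
  refine Nat.le_zero.mp ((exponent_le_iff k p _).mpr fun j _ => ?_)
  rw [invForms_ratPoint_eq_bot_of_lt k p hc hN j, invForms_ratPoint_eq_bot_of_lt k p hc hN 0, Submodule.bot_coe,
    Set.image_singleton]
  have : frobVec k p (j - 0) (0 : Fin (n + 1) → k) = 0 := by
    funext i
    rw [frobVec, Pi.zero_apply, zero_pow (pow_ne_zero _ hp.out.ne_zero)]
  rw [this, Submodule.span_zero_singleton]

/-! ### The purely inseparable point `X_1^p = a X_0^p` of `ℙ¹` -/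

/-- `(1, a)` is `k^p`-linearly independent iff `a ∉ k^p`. [folklore] -/
theorem linearIndependent_one_pair {a : k} (ha : a ∉ frobPow k p 1) : LinearIndependent (frobPow k p 1) ![(1 : k), a] := by
  refine LinearIndependent.pair_iff.mpr fun s t hst => ?_
  simp only [Subfield.smul_def, smul_eq_mul, mul_one] at hst
  by_cases ht : t = 0
  · subst ht
    simp only [ZeroMemClass.coe_zero, zero_mul, add_zero] at hst
    exact ⟨Subtype.ext hst, rfl⟩
  · exfalso
    apply ha
    have ht' : (t : k) ≠ 0 := fun h => ht (Subtype.ext h)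
    have : a = -(s : k) / (t : k) := by
      field_simp
      linear_combination hst
    rw [this]
    exact div_mem (neg_mem s.2) t.2

/-- **THE POINT `X_1^p = a X_0^p` OF `ℙ¹` (`a ∉ k^p`) HAS `B_{P,𝔭} = 𝔸²`**: the `k^{1/p}`-rational point `[1 : a^{1/p}]` of `ℙ¹_k` (a purely inseparable
point of degree `p`) has `U_+(𝔭)S = 0` for EVERY prime `p` — no linear form passes through it and `2 < 2p` coordinates cannot carry an invariant
additive form. [cite: Mizutani1973HironakaGroupSchemes, Def. 1.1, Rem. 1.2 and Thm. 2.8 (first part)] -/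
theorem bIdeal_inseparablePoint_eq_bot {a : k} (ha : a ∉ frobPow k p 1) : bIdeal k (ratPoint k p 1 ![(1 : k), a]) = ⊥ :=
  bIdeal_ratPoint_eq_bot_of_lt k p (n := 1) (linearIndependent_one_pair k p ha) (by have := hp.out.two_le; omega)

/-- The defining form `X_1^p − a X_0^p` indeed lies in the point `[1 : a^{1/p}]`. [folklore] -/
theorem X_pow_sub_mem_inseparablePoint (a : k) :
    (X 1 ^ p - C a * X 0 ^ p : MvPolynomial (Fin 2) k) ∈ ratPoint k p 1 ![(1 : k), a] := by
  have h := C_mul_X_pow_sub_mem_ratPoint (k := k) (p := p) (e := 1) (c := ![(1 : k), a]) 1 0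
  simpa using h

/-- … its exponent is `0` and `dim B = 2`. [cite: Mizutani1973HironakaGroupSchemes, Rem. 1.2] -/
theorem exponent_inseparablePoint {a : k} (ha : a ∉ frobPow k p 1) :
    exponent k p (ratPoint k p 1 ![(1 : k), a]) = 0 ∧
      ringKrullDim (MvPolynomial (Fin 2) k ⧸ bIdeal k (ratPoint k p 1 ![(1 : k), a])) = (2 : ℕ) :=
  ⟨exponent_ratPoint_eq_zero_of_lt k p (n := 1) (linearIndependent_one_pair k p ha) (by have := hp.out.two_le; omega),
    ringKrullDim_quotient_bIdeal_ratPoint_of_lt k p (n := 1) (linearIndependent_one_pair k p ha) (by have := hp.out.two_le; omega)⟩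

end Inseparable

end Summit.ResolutionOfSingularities.KangarooAtlas.Mizutani

end
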